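import Summits.BirchSwinnertonDyer.BirchSwinnertonDyer.Theorems.EisensteinDepletionAtTwoStarSymbCurrencies
import Summits.BirchSwinnertonDyer.BirchSwinnertonDyer.Theorems.EisensteinDepletionAtTwoStarGlueFinScaleLemmas
import Literature.NumberTheory.ModularForms.EtaMultiplierRademacherPhi
import Literature.NumberTheory.ModularForms.RademacherPhiCompositionProofs
import HarnessLib

/-!
# Route `EisensteinDepletionAtTwo`, crux E1M `DepletedLambdaLawAtTwoMod` (stmt-BirchSwinnertonDyer-20341), line `star`:
# (★-EisEightGlobal), part 1 — reduction to Newman's conditions and the exponent vector `r_t = 3N·c_t`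

Cell `bsd-rank2` (HOME run/shared/lean/pub/bsd-rank2/), lead `bsd-rank2-star-p1` GEN 3 (helper `--supports` the crux item; skeleton
`Cruxes/DepletedLambdaLawAtTwoMod/Lines/star.lean` v3.7, stub `stub_starEisEightGlobal`). For odd `N`, an admissible stabilisation
datum `β` (tree `IsAdmissibleStabData`) and a cusp `b/d` with `gcd(d, bN) = 1`, the period `φ_β(γ_{b,d}) = Σ_{t ∣ N} c_t Φ(x, tb; −Ny/t, d)`
of the stabilised weight-2 Eisenstein series along the tree's Bézout matrix `γ_{b,d} = (x, b; −Ny, d)` (`d x + bN y = 1`) satisfies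
`‖φ_β(γ_{b,d})‖₂ ≤ 8⁻¹`. MECHANISM: `3N·φ_β` is the logarithmic period `Σ_t r_t Φ(γ_t)` of the `η`-quotient `∏ η(tz)^{r_t}`,
`r_t = 3N c_t ∈ ℤ`, and `r` satisfies Newman's weight-0 conditions; the tree's `etaQuotient_logPeriod_mem_int` (Newman/Ligozat +
Rademacher (60)) gives `(1/24) Σ r_t Φ(γ_t) ∈ ℤ`, i.e. `N φ_β ∈ 8ℤ`.

* §1 `norm_stabEisensteinPeriod_le_eighth_of_newmanCond` — the reduction: ANY integer vector `r` with `r_t = 3N c_t` on the divisors and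
  `NewmanCond N r 0` gives the bound at every cusp (sign of `c` via `rademacherPhi_neg`; `c = 0` via `Σ c_t t = 0`).
* §2 `exists_exponentVector` — the three LINEAR Newman conditions of `r_t = 3N c_t`: `Σ r_t = 0`, `Σ t r_t = 0`, `24 ∣ Σ (N/t) r_t`
  (the local factors `G_ℓ ∈ {ℓ² − β_ℓ, ℓ⁴ − ℓ³ − ℓ² + ℓ}` of `N² Σ c_t/t`, one of them `≡ 0 (mod 8)` by admissibility).
Part 2 (`…StarEisEightGlobal.lean`) proves the square condition and assembles the stub.

THEOREMS ONLY; no `sorry`; standard axioms. PARTITION: none — r_an ≥ 2, summit axis S0; TWIN (D-0056): n/a. B1 honesty: Dedekind-sum /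
η-multiplier bookkeeping; no elliptic curve appears; nothing reads an analytic rank; (★-SymbC)/(★)/E1M/BSD are NOT proved by this.

References: H. Rademacher, E. Grosswald, *Dedekind Sums* (1972) Ch. 4 A (59)–(62) [RademacherGrosswald1972]; G. Ligozat, *Courbes
modulaires de genre 1*, Mém. SMF 43 (1975) Prop. 3.2.1; M. Newman, *Proc. LMS* (3) 9 (1959); G. Stevens, *Arithmetic on Modular Curves*
(1982) §2.4–2.5 [Stevens1982].
-/

set_option linter.dupNamespace false
set_option autoImplicit false

noncomputable section

open Literature.NumberTheory.ModularForms Literature.NumberTheory.EllipticCurves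
  Literature.NumberTheory.EllipticCurves.ModularForms

namespace Summit.BirchSwinnertonDyer.BirchSwinnertonDyer.Theorems.DepletionAtTwo

variable {N : ℕ} {β : ℕ → ℕ}

/-! ## §1 The reduction to Newman's conditions -/

/-- **(★-EisEightGlobal) from Newman's conditions.** Let `N` be odd, `β` admissible, and `r : ℕ → ℤ` an exponent vector with
`r_t = 3N·c_t` for `t ∣ N` satisfying Newman's weight-`0` conditions. Then for every cusp `b/d` with `d > 0` and `gcd(d, bN) = 1`
the Eisenstein period along the Bézout matrix `(x, b; −Ny, d)` has `‖φ_β‖₂ ≤ 8⁻¹`.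
[cite: RademacherGrosswald1972, Ch. 4 A, eq. (60)] [cite: Stevens1982, §2.5 (PDF p. 38)] -/
theorem norm_stabEisensteinPeriod_le_eighth_of_newmanCond (hodd : Odd N) (hadm : IsAdmissibleStabData N β)
    (r : ℕ → ℤ) (hr : ∀ t ∈ N.divisors, (r t : ℚ) = 3 * N * stabCoeff N β t) (hnc : NewmanCond N r 0)
    (b d : ℤ) (hd : 0 < d) (hcop : Int.gcd d (b * N) = 1) :
    ‖((stabEisensteinPeriod N β (Int.gcdA d (b * N)) b (-(N : ℤ) * Int.gcdB d (b * N)) d : ℚ) : ℚ_[2])‖ ≤ 8⁻¹ := by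
  have hN : N ≠ 0 := fun h ↦ by simp [h] at hodd
  set x : ℤ := Int.gcdA d (b * N) with hx
  set y : ℤ := Int.gcdB d (b * N) with hy
  have hbez : d * x + b * N * y = 1 := by
    have h := Int.gcd_eq_gcd_ab d (b * N)
    rw [hcop] at h; push_cast at h; linear_combination -h
  -- the period as a divisor sum, and `3N·φ = Σ r_t Φ_t`
  have hsum : ∀ (a c : ℤ), 3 * (N : ℚ) * stabEisensteinPeriod N β a b c d =
      ∑ t ∈ N.divisors, (r t : ℚ) * rademacherPhi a (t * b) (c / t) d := by
    intro a c
    rw [stabEisensteinPeriod_eq, Finset.mul_sum]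
    refine Finset.sum_congr rfl fun t ht ↦ ?_
    rw [hr t ht]; ring
  by_cases hy0 : y = 0
  · -- `c = 0`: then `d = 1`, `Φ(x, tb; 0, 1) = tb`, and `Σ c_t t = 0`
    have hd1 : d * x = 1 := by rw [hy0] at hbez; linear_combination hbez
    have hd1' : d = 1 := Int.eq_one_of_mul_eq_one_right hd.le hd1
    have h0 : stabEisensteinPeriod N β x b (-(N : ℤ) * y) d = 0 := by
      rw [hy0, mul_zero, hd1', stabEisensteinPeriod_eq]
      have : ∀ t ∈ N.divisors, stabCoeff N β t * rademacherPhi x (t * b) ((0 : ℤ) / t) 1 =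
          (b : ℚ) * (stabCoeff N β t * t) := by
        intro t _
        rw [Int.zero_ediv, rademacherPhi_of_c_eq_zero]; push_cast; ring
      rw [Finset.sum_congr rfl this, ← Finset.mul_sum, sum_divisors_stabCoeff_mul_self_eq_zero hN hadm, mul_zero]
    rw [h0]; simp
  · -- `c = −Ny ≠ 0`: Newman–Ligozat integrality on `±γ`
    have hc0 : -(N : ℤ) * y ≠ 0 := mul_ne_zero (neg_ne_zero.mpr (by exact_mod_cast hN)) hy0
    obtain ⟨n, hn⟩ : ∃ n : ℤ, 3 * (N : ℚ) * stabEisensteinPeriod N β x b (-(N : ℤ) * y) d = 24 * n := by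
      rcases lt_or_gt_of_ne hc0 with hneg | hpos
      · -- flip the sign of the whole matrix
        have hdet : (-x) * (-d) - (-b) * (-(-(N : ℤ) * y)) = 1 := by linear_combination hbez
        obtain ⟨n, hn⟩ := etaQuotient_logPeriod_mem_int N r hnc hdet (by linarith) ⟨y, by ring⟩
        refine ⟨n, ?_⟩
        rw [hsum]
        have : ∀ t ∈ N.divisors, (r t : ℚ) * rademacherPhi x (t * b) (-(N : ℤ) * y / t) d =
            (r t : ℚ) * rademacherPhi (-x) (t * -b) (-(-(N : ℤ) * y) / t) (-d) := by
          intro t ht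
          have htc : (t : ℤ) ∣ -(N : ℤ) * y :=
            Dvd.dvd.mul_right ((Int.natCast_dvd_natCast.mpr (Nat.dvd_of_mem_divisors ht)).neg_right) y
          rw [Int.neg_ediv_of_dvd htc, show (t : ℤ) * -b = -(t * b) by ring, rademacherPhi_neg]
        rw [Finset.sum_congr rfl this]
        linear_combination 24 * hn
      · have hdet : x * d - b * (-(N : ℤ) * y) = 1 := by linear_combination hbez
        obtain ⟨n, hn⟩ := etaQuotient_logPeriod_mem_int N r hnc hdet hpos ⟨-y, by ring⟩
        exact ⟨n, by rw [hsum]; linear_combination 24 * hn⟩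
    -- `φ = 8 n / N`, `‖N‖₂ = 1`
    have hN0 : (N : ℚ) ≠ 0 := by exact_mod_cast hN
    have hφ : stabEisensteinPeriod N β x b (-(N : ℤ) * y) d = 8 * (n : ℚ) / N := by
      rw [eq_div_iff hN0]; linear_combination hn / 3
    have hNnorm : ‖((N : ℤ) : ℚ_[2])‖ = 1 := norm_intCast_eq_one_of_odd (by exact_mod_cast hodd)
    rw [hφ, Rat.cast_div, Rat.cast_mul, Rat.cast_natCast, Rat.cast_intCast, Rat.cast_ofNat, norm_div, norm_mul]
    rw [show ((N : ℚ_[2])) = ((N : ℤ) : ℚ_[2]) by push_cast; rfl, hNnorm, div_one]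
    calc ‖(8 : ℚ_[2])‖ * ‖(n : ℚ_[2])‖ ≤ ‖(8 : ℚ_[2])‖ * 1 := by gcongr; exact Padic.norm_int_le_one n
      _ = 8⁻¹ := by rw [mul_one, norm_eight_padic_two]

/-! ## §2 The exponent vector `r_t = 3N·c_t` and its linear Newman conditions -/

/-- The local factor `G_ℓ = ℓ^{2e_ℓ} · Σ_{j ≤ e_ℓ} c_ℓ(j) ℓ^{−j}` of `N² Σ_t c_t/t` is the INTEGER `ℓ² − β_ℓ` (`ℓ ∥ N`) resp.
`ℓ⁴ − ℓ³ − ℓ² + ℓ` (`ℓ² ∥ N`). [cite: Stevens1982, §2.4 (PDF pp. 35–37)] -/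
theorem localFactor_inv_eq (hadm : IsAdmissibleStabData N β) {ℓ : ℕ} (hℓ : ℓ ∈ N.primeFactors) :
    ((ℓ : ℚ) ^ N.factorization ℓ) ^ 2 *
        ∑ j ∈ Finset.range (N.factorization ℓ + 1), stabCoeff N β (ℓ ^ j) * (((ℓ ^ j : ℕ) : ℚ))⁻¹ =
      ((if N.factorization ℓ = 1 then (ℓ : ℤ) ^ 2 - β ℓ else (ℓ : ℤ) ^ 4 - ℓ ^ 3 - ℓ ^ 2 + ℓ : ℤ) : ℚ) := by
  have hℓ0 : (ℓ : ℚ) ≠ 0 := by exact_mod_cast (Nat.prime_of_mem_primeFactors hℓ).ne_zero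
  have hsum : ∑ j ∈ Finset.range (N.factorization ℓ + 1), stabCoeff N β (ℓ ^ j) * (((ℓ ^ j : ℕ) : ℚ))⁻¹ =
      ∑ j ∈ Finset.range (N.factorization ℓ + 1), algebraMap ℚ ℚ (localStabCoeff N β ℓ j) * ((ℓ : ℚ)⁻¹) ^ j := by
    refine Finset.sum_congr rfl fun j _ ↦ ?_
    rw [stabCoeff_prime_pow N β hℓ, Algebra.algebraMap_self, RingHom.id_apply]
    push_cast
    rw [inv_pow]
  rw [hsum]
  rcases factorization_eq_one_or_two_of_admissible hadm hℓ with h1 | h2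
  · rw [sum_range_localStabCoeff_of_eq_one N β h1, if_pos h1, h1]
    simp only [Algebra.algebraMap_self, RingHom.id_apply]
    push_cast
    field_simp
    try ring
  · rw [sum_range_localStabCoeff_of_eq_two N β h2, if_neg (by omega), h2]
    simp only [Algebra.algebraMap_self, RingHom.id_apply]
    push_cast
    field_simp
    try ring

/-- `8 ∣ G_ℓ` at a prime with `ℓ² ∥ N`, or with `ℓ ∥ N` and `β_ℓ = 1` (`ℓ` odd: `8 ∣ ℓ² − 1`). [folklore] -/
theorem eight_dvd_localFactor {ℓ : ℕ} (hℓodd : Odd ℓ)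
    (h : N.factorization ℓ = 2 ∨ (N.factorization ℓ = 1 ∧ β ℓ = 1)) :
    (8 : ℤ) ∣ (if N.factorization ℓ = 1 then (ℓ : ℤ) ^ 2 - β ℓ else (ℓ : ℤ) ^ 4 - ℓ ^ 3 - ℓ ^ 2 + ℓ) := by
  obtain ⟨k, hk⟩ := hℓodd
  have h8 : (8 : ℤ) ∣ (ℓ : ℤ) ^ 2 - 1 := by
    obtain ⟨m, hm⟩ := Int.even_mul_succ_self k
    refine ⟨m, ?_⟩
    have : (ℓ : ℤ) = 2 * k + 1 := by exact_mod_cast hk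
    rw [this]; linear_combination 4 * hm
  rcases h with h2 | ⟨h1, hb⟩
  · rw [if_neg (by omega)]
    have e : (ℓ : ℤ) ^ 4 - ℓ ^ 3 - ℓ ^ 2 + ℓ = ((ℓ : ℤ) ^ 2 - 1) * (ℓ ^ 2 - ℓ) := by ring
    rw [e]; exact h8.mul_right _
  · rw [if_pos h1, hb]; push_cast; exact h8

/-- **An exponent vector for `3N·φ_β` satisfying the three LINEAR Newman conditions** (weight `0`, both cusp sums `≡ 0 (mod 24)`):
`r_t = 3N c_t ∈ ℤ` with `Σ r_t = 0` (`Σ c_t = 0`), `Σ t r_t = 0` (`Σ c_t t = 0`) and `24 ∣ Σ (N/t) r_t` (`N² Σ c_t/t = ∏_ℓ G_ℓ` with one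
`G_ℓ ≡ 0 (mod 8)` by admissibility). [cite: Stevens1982, §2.4–2.5 (PDF pp. 35–38)] -/
theorem exists_exponentVector (hodd : Odd N) (hadm : IsAdmissibleStabData N β) :
    ∃ r : ℕ → ℤ, (∀ t ∈ N.divisors, (r t : ℚ) = 3 * N * stabCoeff N β t) ∧
      (∑ t ∈ N.divisors, r t = 2 * 0) ∧ ((24 : ℤ) ∣ ∑ t ∈ N.divisors, (t : ℤ) * r t) ∧
      ((24 : ℤ) ∣ ∑ t ∈ N.divisors, ((N / t : ℕ) : ℤ) * r t) ∧
      (∀ t, ∃ z : ℤ, r t = 3 * z ∧ (z : ℚ) = N * stabCoeff N β t) := by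
  have hN : N ≠ 0 := fun h ↦ by simp [h] at hodd
  have hz : ∀ t, ∃ z : ℤ, (N : ℚ) * stabCoeff N β t = z := fun t ↦ exists_int_natCast_mul_stabCoeff hN t
  choose z hz using hz
  refine ⟨fun t ↦ 3 * z t, fun t _ ↦ by push_cast; rw [← hz t]; ring, ?_, ?_, ?_, fun t ↦ ⟨z t, rfl, (hz t).symm⟩⟩
  · -- `Σ r_t = 0`
    have h : ((∑ t ∈ N.divisors, 3 * z t : ℤ) : ℚ) = 0 := by
      push_cast
      simp_rw [← hz]
      rw [← Finset.mul_sum, ← Finset.mul_sum, sum_divisors_stabCoeff_eq_zero hN hadm, mul_zero, mul_zero]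
    rw [mul_zero]; exact_mod_cast h
  · -- `Σ t r_t = 0`
    have h : ((∑ t ∈ N.divisors, (t : ℤ) * (3 * z t) : ℤ) : ℚ) = 0 := by
      push_cast
      have : ∀ t ∈ N.divisors, (t : ℚ) * (3 * (z t : ℚ)) = 3 * N * (stabCoeff N β t * t) := by
        intro t _; rw [← hz t]; ring
      rw [Finset.sum_congr rfl this, ← Finset.mul_sum, sum_divisors_stabCoeff_mul_self_eq_zero hN hadm, mul_zero]
    have h' : ∑ t ∈ N.divisors, (t : ℤ) * (3 * z t) = 0 := by exact_mod_cast h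
    rw [h']; exact dvd_zero _
  · -- `24 ∣ Σ (N/t) r_t`: `Σ (N/t)·N c_t = ∏_ℓ G_ℓ`
    set u : ℕ → ℤ := fun ℓ ↦ if N.factorization ℓ = 1 then (ℓ : ℤ) ^ 2 - β ℓ else (ℓ : ℤ) ^ 4 - ℓ ^ 3 - ℓ ^ 2 + ℓ
      with hu
    have hQ : ((∑ t ∈ N.divisors, ((N / t : ℕ) : ℤ) * z t : ℤ) : ℚ) = ((∏ ℓ ∈ N.primeFactors, u ℓ : ℤ) : ℚ) := by
      simp only [Int.cast_sum, Int.cast_mul, Int.cast_natCast, Int.cast_prod]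
      -- left side `= N² Σ c_t t⁻¹`
      have h1 : ∀ t ∈ N.divisors, ((N / t : ℕ) : ℚ) * (z t : ℚ) =
          (N : ℚ) ^ 2 * (algebraMap ℚ ℚ (stabCoeff N β t) * ((t : ℚ))⁻¹) := by
        intro t ht
        have ht0 : (t : ℚ) ≠ 0 := by exact_mod_cast (Nat.pos_of_mem_divisors ht).ne'
        rw [Algebra.algebraMap_self, RingHom.id_apply, ← hz t, Nat.cast_div (Nat.dvd_of_mem_divisors ht) ht0]
        field_simp
      rw [Finset.sum_congr rfl h1, ← Finset.mul_sum,
        sum_divisors_stabCoeff_mul N β (R := ℚ) (fun t ↦ ((t : ℚ))⁻¹) (by simp)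
          (fun m n _ _ _ ↦ by push_cast; rw [mul_inv]) hN]
      -- `N² = ∏_ℓ (ℓ^{e_ℓ})²`
      have hNprod : (N : ℚ) = ∏ ℓ ∈ N.primeFactors, ((ℓ : ℚ) ^ N.factorization ℓ) := by
        conv_lhs => rw [← Nat.prod_factorization_pow_eq_self hN]
        rw [Nat.prod_factorization_eq_prod_primeFactors]
        push_cast
        rfl
      rw [hNprod, ← Finset.prod_pow, ← Finset.prod_mul_distrib]
      refine Finset.prod_congr rfl fun ℓ hℓ ↦ ?_
      rw [← localFactor_inv_eq hadm hℓ]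
      simp only [Algebra.algebraMap_self, RingHom.id_apply]
    have hQ' : ∑ t ∈ N.divisors, ((N / t : ℕ) : ℤ) * z t = ∏ ℓ ∈ N.primeFactors, u ℓ := by exact_mod_cast hQ
    -- a local factor divisible by `8`
    obtain ⟨ℓ₀, hℓ₀, h8⟩ : ∃ ℓ₀ ∈ N.primeFactors, (8 : ℤ) ∣ u ℓ₀ := by
      have hoddℓ : ∀ ℓ ∈ N.primeFactors, Odd ℓ := fun ℓ hℓ ↦ hodd.of_dvd_nat (Nat.dvd_of_mem_primeFactors hℓ)
      rcases hadm.2.2 with ⟨ℓ, hℓ, h2⟩ | ⟨-, ⟨ℓ, hℓ, hb⟩⟩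
      · exact ⟨ℓ, hℓ, eight_dvd_localFactor (hoddℓ ℓ hℓ) (Or.inl h2)⟩
      · rcases factorization_eq_one_or_two_of_admissible hadm hℓ with h1 | h2
        · exact ⟨ℓ, hℓ, eight_dvd_localFactor (hoddℓ ℓ hℓ) (Or.inr ⟨h1, hb⟩)⟩
        · exact ⟨ℓ, hℓ, eight_dvd_localFactor (hoddℓ ℓ hℓ) (Or.inl h2)⟩
    have h3 : ∑ t ∈ N.divisors, ((N / t : ℕ) : ℤ) * (3 * z t) = 3 * ∑ t ∈ N.divisors, ((N / t : ℕ) : ℤ) * z t := by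
      rw [Finset.mul_sum]; refine Finset.sum_congr rfl fun t _ ↦ by ring
    rw [h3, hQ', show (24 : ℤ) = 3 * 8 by norm_num]
    exact mul_dvd_mul_left 3 (h8.trans (Finset.dvd_prod_of_mem u hℓ₀))



end Summit.BirchSwinnertonDyer.BirchSwinnertonDyer.Theorems.DepletionAtTwo

end
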